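import Literature.NumberTheory.LFunctions.WeilTwoPrimeDeflM72YBase
import Literature.NumberTheory.LFunctions.WeilBlockRowsFast
import HarnessLib

/-!
# Deflated two-prime certificate M72Y: the odd Bessel block claim `Hp = C H Cᵀ`, rows 50–54 (fast linear-traversal check)

The rows are checked with `WeilCert.checkHpRowT` (linear traversals, triangular storage of `weilCert23HC`) instead of the
indexed `checkHpRow` decide.  Pure proof file.
-/

noncomputable section

namespace Literature.NumberTheory.LFunctions

set_option maxHeartbeats 0 in
/-- Fast kernel check of claim row 50 of `Hp = C H Cᵀ` (odd block, certificate M72Y; triangular `C`). [folklore] -/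
theorem checkHpRowT1_50_weilCertDeflM72Y : weilCertDeflM72YBase.checkHpRowT weilCertDeflM72YHpO 1 50 = true := by
  decide +kernel

/-- Claim row 50 of `Hp = C H Cᵀ` (odd block, certificate M72Y), from the fast check. [folklore] -/
theorem checkHpRow1_50_weilCertDeflM72Y : weilCertDeflM72YBase.checkHpRow weilCertDeflM72YHpO 1 50 = true :=
  WeilCert.checkHpRow_of_T checkHpRowT1_50_weilCertDeflM72Y

set_option maxHeartbeats 0 in
/-- Fast kernel check of claim row 51 of `Hp = C H Cᵀ` (odd block, certificate M72Y; triangular `C`). [folklore] -/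
theorem checkHpRowT1_51_weilCertDeflM72Y : weilCertDeflM72YBase.checkHpRowT weilCertDeflM72YHpO 1 51 = true := by
  decide +kernel

/-- Claim row 51 of `Hp = C H Cᵀ` (odd block, certificate M72Y), from the fast check. [folklore] -/
theorem checkHpRow1_51_weilCertDeflM72Y : weilCertDeflM72YBase.checkHpRow weilCertDeflM72YHpO 1 51 = true :=
  WeilCert.checkHpRow_of_T checkHpRowT1_51_weilCertDeflM72Y

set_option maxHeartbeats 0 in
/-- Fast kernel check of claim row 52 of `Hp = C H Cᵀ` (odd block, certificate M72Y; triangular `C`). [folklore] -/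
theorem checkHpRowT1_52_weilCertDeflM72Y : weilCertDeflM72YBase.checkHpRowT weilCertDeflM72YHpO 1 52 = true := by
  decide +kernel

/-- Claim row 52 of `Hp = C H Cᵀ` (odd block, certificate M72Y), from the fast check. [folklore] -/
theorem checkHpRow1_52_weilCertDeflM72Y : weilCertDeflM72YBase.checkHpRow weilCertDeflM72YHpO 1 52 = true :=
  WeilCert.checkHpRow_of_T checkHpRowT1_52_weilCertDeflM72Y

set_option maxHeartbeats 0 in
/-- Fast kernel check of claim row 53 of `Hp = C H Cᵀ` (odd block, certificate M72Y; triangular `C`). [folklore] -/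
theorem checkHpRowT1_53_weilCertDeflM72Y : weilCertDeflM72YBase.checkHpRowT weilCertDeflM72YHpO 1 53 = true := by
  decide +kernel

/-- Claim row 53 of `Hp = C H Cᵀ` (odd block, certificate M72Y), from the fast check. [folklore] -/
theorem checkHpRow1_53_weilCertDeflM72Y : weilCertDeflM72YBase.checkHpRow weilCertDeflM72YHpO 1 53 = true :=
  WeilCert.checkHpRow_of_T checkHpRowT1_53_weilCertDeflM72Y

set_option maxHeartbeats 0 in
/-- Fast kernel check of claim row 54 of `Hp = C H Cᵀ` (odd block, certificate M72Y; triangular `C`). [folklore] -/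
theorem checkHpRowT1_54_weilCertDeflM72Y : weilCertDeflM72YBase.checkHpRowT weilCertDeflM72YHpO 1 54 = true := by
  decide +kernel

/-- Claim row 54 of `Hp = C H Cᵀ` (odd block, certificate M72Y), from the fast check. [folklore] -/
theorem checkHpRow1_54_weilCertDeflM72Y : weilCertDeflM72YBase.checkHpRow weilCertDeflM72YHpO 1 54 = true :=
  WeilCert.checkHpRow_of_T checkHpRowT1_54_weilCertDeflM72Y

end Literature.NumberTheory.LFunctions
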